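import Summits.Ventures.HodgeRepro.Night3WeilModel
import Summits.Ventures.HodgeRepro.Night3FaceClosureGSetFull

/-!
# The Weil model with the Künneth PROJECTION and the cross PRODUCT as separate fields: `hmul` in its honest form

Blind re-derivation cell `pub-hodge-repro`, seat `night-3` (gen 4).  Imports night-3's `Night3WeilModel` (gen 2's
`WeilModel`, the linear algebra of Lemma P in `LemmaP.*`) and `Night3FaceClosureGSetFull` (gen 0's
`alg_of_faces_gset_full`).  Namespace `HodgeRepro.Night3`.

WHY A VARIANT (gen 4's erratum, INBOX L6047).  Gen 2's `WeilModel` has ONE map `κ : H (a + b) → H a ⊗ H b` and states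
product closure as `hmul : (Alg a ⊗ Alg b).comap κ ≤ Alg (a + b)`.  That form is the honest «products of pull-backs of
algebraic classes are algebraic» only when `κ` is INJECTIVE (the full Künneth isomorphism).  On the concrete model of
gen 4 (`Night3GSetWeilModel`), where `H M = H^{|M|}(B_M, ℂ)` is ONE degree and `κ` is the `(n, k)`-COMPONENT PROJECTION
`H^{n+k}(B_M × B_N) → H^n(B_M) ⊗ H^k(B_N)`, the comap form would ask every class in `ker κ` (the other Künneth summands) to
be algebraic — false for the geometric `Alg`.  So this file keeps BOTH maps:

* `κ` — the Künneth component projection (used by cancellation, `hproj`: only the `(n, k)`-summand survives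
  `pr_{B_a *}((·) ∪ pr_{B_b}^*(y ∪ Λ))`, by degree), and
* `μ : H a ⊗ H b → H (a + b)` — the cross product `x ⊗ y ↦ pr_a^* x ∪ pr_b^* y` (the inclusion of the `(n, k)`-summand),
  with `hμℓ : μ (ℓ_σ(a) ⊗ ℓ_σ(b)) = ℓ_σ(a + b)` (the line of the product is the product of the lines) and the HONEST
  `hmul : (Alg a ⊗ Alg b).map μ ≤ Alg (a + b)` (Fulton Ch. 19 / Voisin I Thm 11.38, SOURCES LP3-print).

Theorems: `WeilModelKP.alg_add` (step (1): `W (a+b)` is spanned over `L` by the `μ (ℓ_σ ⊗ ℓ_σ)`, each in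
`(W a ⊗ W b).map μ ⊗ L ≤ (Alg a ⊗ Alg b).map μ ⊗ L`, and `LemmaP.le_of_baseChange_eq_span` descends to `K`),
`WeilModelKP.alg_cancel` (steps (2)–(3): gen 2's proof verbatim — it uses only `κ`, `hℓ`, `hW`, `hQ`, `hproj`),
`WeilModelKP.alg_of_faces_gset` («S4-faces ⟹ S4» on typer's `(G, c)` model, gen 0's closure theorem with Lemma P
supplied by the two theorems).  Nothing here closes S4; no sealed file is touched; no Tier-2 item depends on this file.
-/

set_option autoImplicit false

open TensorProduct
open scoped Pointwise

namespace HodgeRepro.Night3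

universe u

/-- A **Weil model with projection and product**: gen 2's `WeilModel` with the Künneth component projection `κ` AND the
cross product `μ` as fields, product closure stated on `μ` (the honest form, see the module docstring). -/
structure WeilModelKP (K L : Type*) [Field K] [Field L] [Algebra K L] (ι : Type*) (A : Type*) [AddCommMonoid A] where
  /-- the cohomology `H^•(B_a)` (in the concrete model: the degree of the Weil space only) -/
  H : A → Type u
  [acg : ∀ a, AddCommGroup (H a)]
  [mod : ∀ a, Module K (H a)]
  /-- the Künneth component projection `H^{n+k}(B_a × B_b) → H^n(B_a) ⊗ H^k(B_b)` -/
  κ : ∀ a b, H (a + b) →ₗ[K] H a ⊗[K] H b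
  /-- the cross product `x ⊗ y ↦ pr_a^* x ∪ pr_b^* y` (the inclusion of the `(n, k)`-summand) -/
  μ : ∀ a b, H a ⊗[K] H b →ₗ[K] H (a + b)
  /-- the generator `w_σ(B_a)` of the `σ`-line, in `H^•(B_a) ⊗ L` -/
  ℓ : ∀ a, ι → L ⊗[K] H a
  /-- the Weil space `W_F(B_a)` (a `K`-form) -/
  W : ∀ a, Submodule K (H a)
  /-- the algebraic classes of `B_a` -/
  Alg : ∀ a, Submodule K (H a)
  /-- the form `Q′(x, y) = ∫_{B_a} x ∪ y ∪ Λ` -/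
  Q : ∀ a, LinearMap.BilinForm K (H a)
  /-- `W_F(B_a) ⊗ L = ⊕_σ ℓ_σ(B_a)` -/
  hW : ∀ a, (W a).baseChange L = Submodule.span L (Set.range (ℓ a))
  /-- the eigenline identification under the projection: `κ (ℓ_σ(B_a × B_b)) = ℓ_σ(B_a) ⊗ ℓ_σ(B_b)` -/
  hℓ : ∀ a b σ, (κ a b).baseChange L (ℓ (a + b) σ) =
    (AlgebraTensorModule.distribBaseChange K L (H a) (H b)).symm (ℓ a σ ⊗ₜ[L] ℓ b σ)
  /-- the eigenline identification under the product: `μ (ℓ_σ(B_a) ⊗ ℓ_σ(B_b)) = ℓ_σ(B_a × B_b)` -/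
  hμℓ : ∀ a b σ, (μ a b).baseChange L
    ((AlgebraTensorModule.distribBaseChange K L (H a) (H b)).symm (ℓ a σ ⊗ₜ[L] ℓ b σ)) = ℓ (a + b) σ
  /-- products of pull-backs of algebraic classes are algebraic (the honest form) -/
  hmul : ∀ a b, (Submodule.map₂ (TensorProduct.mk K (H a) (H b)) (Alg a) (Alg b)).map (μ a b) ≤ Alg (a + b)
  /-- the correspondence `pr_{B_a *}((·) ∪ pr_{B_b}^*(y ∪ Λ))`, `y` algebraic, maps algebraic classes to algebraic
  classes (only the `(n, k)`-summand survives, by degree: the contraction against `Q_b(·, y)` after `κ`) -/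
  hproj : ∀ a b (y : H b), y ∈ Alg b →
    ((Alg (a + b)).map (κ a b)).map (LemmaP.contract ((Q b).flip y)) ≤ Alg a
  /-- for `b ≠ 0` every line pairs non-trivially with some line -/
  hQ : ∀ b, b ≠ 0 → ∀ σ, ∃ τ, (Q b).baseChange L (ℓ b σ) (ℓ b τ) ≠ 0

attribute [instance] WeilModelKP.acg WeilModelKP.mod

namespace WeilModelKP

variable {K L : Type*} [Field K] [Field L] [Algebra K L] {ι : Type*} {A : Type*} [AddCommMonoid A]
variable (X : WeilModelKP.{u} K L ι A)

/-- Every line lies in the base change of the Weil space. -/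
theorem line_mem_baseChange (a : A) (σ : ι) : X.ℓ a σ ∈ (X.W a).baseChange L := by
  rw [X.hW]; exact Submodule.subset_span ⟨σ, rfl⟩

/-- **Lemma P, step (1) — product closure, in the honest form**: if `W_F(B_a)` and `W_F(B_b)` are algebraic, so is
`W_F(B_a × B_b)`.  Proof: `W (a+b) ⊗ L` is spanned by the lines `ℓ_σ(a+b) = μ_L (ℓ_σ(a) ⊗ ℓ_σ(b))` (`hμℓ`), each in
`((W a ⊗ W b).map μ) ⊗ L` (Künneth, `distribBaseChange_symm_tmul_mem`, `baseChange_map`), hence in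
`((Alg a ⊗ Alg b).map μ) ⊗ L`; descent (`le_of_baseChange_eq_span`) and `hmul` finish. -/
theorem alg_add (a b : A) (ha : X.W a ≤ X.Alg a) (hb : X.W b ≤ X.Alg b) :
    X.W (a + b) ≤ X.Alg (a + b) := by
  refine (LemmaP.le_of_baseChange_eq_span (X.hW (a + b)) fun σ => ?_).trans (X.hmul a b)
  rw [LemmaP.baseChange_map, ← X.hμℓ a b σ]
  exact Submodule.mem_map_of_mem (Submodule.baseChange_mono (A := L) (Submodule.map₂_le_map₂ ha hb)
    (LemmaP.distribBaseChange_symm_tmul_mem (X.line_mem_baseChange a σ) (X.line_mem_baseChange b σ)))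

/-- **Lemma P, steps (2)–(3) — cancellation** (gen 2's `WeilModel.alg_cancel`, the same proof: only `κ`, `hℓ`, `hW`,
`hQ`, `hproj` are used). -/
theorem alg_cancel [Infinite K] [Fintype ι] (a b : A) (hab : X.W (a + b) ≤ X.Alg (a + b))
    (hb : X.W b ≤ X.Alg b) : X.W a ≤ X.Alg a := by
  by_cases h0 : b = 0
  · subst h0; rwa [add_zero] at hab
  obtain ⟨y, hyW, hy⟩ := LemmaP.exists_mem_forall_ne_zero (L := L) (X.W b)
    (fun σ => (X.Q b).baseChange L (X.ℓ b σ)) (fun σ => by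
      obtain ⟨τ, hτ⟩ := X.hQ b h0 σ
      exact ⟨X.ℓ b τ, X.line_mem_baseChange b τ, hτ⟩)
  let φ : Module.Dual K (X.H b) := (X.Q b).flip y
  let Φ : X.H (a + b) →ₗ[K] X.H a := LemmaP.contract φ ∘ₗ X.κ a b
  have hc : ∀ σ, LemmaP.extendDual (L := L) φ (X.ℓ b σ) ≠ 0 := fun σ => by
    rw [LemmaP.extendDual_flip_eq_baseChange]; exact hy σ
  have hΦ : ∀ σ, Φ.baseChange L (X.ℓ (a + b) σ) = LemmaP.extendDual (L := L) φ (X.ℓ b σ) • X.ℓ a σ := by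
    intro σ
    show (LemmaP.contract φ ∘ₗ X.κ a b).baseChange L (X.ℓ (a + b) σ) = _
    rw [LinearMap.baseChange_comp, LinearMap.comp_apply, X.hℓ,
      LemmaP.baseChange_contract_distribBaseChange_symm_tmul]
  have hmap : (X.W (a + b)).map Φ = X.W a :=
    LemmaP.map_eq_of_baseChange_span Φ (X.ℓ (a + b)) (X.ℓ a) _ hc hΦ (X.hW _) (X.hW _)
  rw [← hmap]
  calc (X.W (a + b)).map Φ ≤ (X.Alg (a + b)).map Φ := Submodule.map_mono hab
    _ = ((X.Alg (a + b)).map (X.κ a b)).map (LemmaP.contract φ) := Submodule.map_comp _ _ _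
    _ ≤ X.Alg a := X.hproj a b y (hb hyW)

/-- **«S4-faces ⟹ S4» in a Weil model with projection and product, on the `(G, c)` model** (gen 0's closure theorem
with Lemma P supplied by `alg_add` / `alg_cancel`). -/
theorem alg_of_faces_gset [Infinite K] [Fintype ι] {G : Type*} [Group G] [DecidableEq G] [Fintype G]
    {c : G} (hc : IsComplexConj c) (X : WeilModelKP.{u} K L ι (Multiset (Finset G)))
    (hpair : ∀ Φ, IsCMType c Φ → X.W {Φ, c • Φ} ≤ X.Alg {Φ, c • Φ})
    (hface : ∀ Φ p p', IsCMType c Φ → p' ∉ place c p →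
      X.W (GSet.faceCornersMul c Φ p p') ≤ X.Alg (GSet.faceCornersMul c Φ p p'))
    (M : Multiset (Finset G)) (hM : GSet.IsZeroSumG c M) : X.W M ≤ X.Alg M :=
  GSet.alg_of_faces_gset_full hc (fun N => X.W N ≤ X.Alg N)
    (fun M N _ _ => X.alg_add M N) (fun M N _ _ => X.alg_cancel M N) hpair hface M hM

end WeilModelKP

end HodgeRepro.Night3
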